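import Summits.QuantumFields.QCD.Theses.HeatSlicedQuarks
import Summits.QuantumFields.QCD.Theorems.TracedQuadraticParametrix.Negative.FalseWithoutRLeL

/-!
# `QuarkLoopCoefficient` — negative-side support II: the time cap `t ≤ L²` is load-bearing

Support file for crux `stmt-QuantumFields-16786` (`HeatSlicedQuarks.QuarkLoopCoefficient`, rank 7), extracted from the
standing disprover's work file `Cruxes/QuarkLoopCoefficient/Disproof.lean` §4 (cdisprove cycle 1, 2026-08-17).  It reuses
the one-site toron toolkit of the sibling `TracedQuadraticParametrix/Negative/FalseWithoutRLeL.lean` (`toron`,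
`trDiag_toron = 8e^{−4t} + 4`, `trDiag_free_one = 12`, `plaquetteHolonomy_toron`); nothing is posited, no `sorry`.

* `QuarkLoopCoefficientWithoutTimeCap`: the crux with `t ≤ L²` dropped (verbatim otherwise).
* `quarkLoopCoefficient_false_without_timeCap`: the flat toron on `L = 1` (`θ = 0`, all hypotheses hold) has traced
  kernel deficit `8 − 8e^{−4t} ≥ 4` for `t ≥ 1` while the allowance is `Ce^{−c/(t+1)}/t² ≤ |C|/t → 0`: any proof of the
  crux must use the cap.  Reading: in the crux the image allowance at `t = L²` is `≍ C/L⁴`, exactly the zero-mode scale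
  `12/L⁴` — the finite-volume tail `Ce^{−cL²/(t+L)}/t²` is sharp in the time direction as well as in `L` (17986).
-/

noncomputable section

namespace Summit.QuantumFields.QCD.Theorems.QuarkLoopCoefficient.Negative

open Literature.MathematicalPhysics.QuantumLattice Literature.MathematicalPhysics.QuantumFieldTheory
open Literature.Probability.LatticeModels (Site TorusSite)
open Summit.QuantumFields.QCD.Theses.HeatSlicedQuarks
open scoped Matrix ComplexConjugate

/-! ### §4 The time cap `t ≤ L²` is load-bearing (toron zero-mode deficit at `t → ∞`) -/

/-- The crux with the cap `t ≤ L²` DROPPED (verbatim otherwise). -/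
def QuarkLoopCoefficientWithoutTimeCap : Prop :=
  ∃ C c : ℝ, 0 < c ∧ ∀ (L : ℕ) [NeZero L] (U : Literature.MathematicalPhysics.QuantumFieldTheory.GaugeConfig 4 L (Matrix.specialUnitaryGroup (Fin 3) ℂ)) (θ : ℝ), (∀ (e : Literature.MathematicalPhysics.QuantumFieldTheory.Edge 4 L) (i j : Fin 3), i ≠ j → (Literature.MathematicalPhysics.QuantumLattice.fundamentalRep (Fin 3)) (U e) i j = 0) → (∀ y : Literature.Probability.LatticeModels.TorusSite 4 L, (Literature.MathematicalPhysics.QuantumLattice.fundamentalRep (Fin 3)) (Literature.MathematicalPhysics.QuantumFieldTheory.plaquetteHolonomy U y 0 1) = Matrix.diagonal ![Complex.exp (Complex.I * θ), Complex.exp (-(Complex.I * θ)), 1]) → (∀ (y : Literature.Probability.LatticeModels.TorusSite 4 L) (μ ν : Fin 4), ¬(μ = 0 ∧ ν = 1) → ¬(μ = 1 ∧ ν = 0) → Literature.MathematicalPhysics.QuantumFieldTheory.plaquetteHolonomy U y μ ν = 1) → ∀ (t : ℝ), 1 ≤ t → t * |θ| ≤ 1 → ∀ (x : Literature.Probability.LatticeModels.TorusSite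 4 L), |(∑ a : Fin 3, ∑ α : Fin 4, ((NormedSpace.exp (-(t : ℂ) • (Matrix.conjTranspose (Literature.MathematicalPhysics.QuantumLattice.wilsonDirac (Literature.MathematicalPhysics.QuantumLattice.fundamentalRep (Fin 3)) U 0 1) * Literature.MathematicalPhysics.QuantumLattice.wilsonDirac (Literature.MathematicalPhysics.QuantumLattice.fundamentalRep (Fin 3)) U 0 1))) (x, a, α) (x, a, α)).re) - (∑ a : Fin 3, ∑ α : Fin 4, ((NormedSpace.exp (-(t : ℂ) • (Matrix.conjTranspose (Literature.MathematicalPhysics.QuantumLattice.wilsonDirac (Literature.MathematicalPhysics.QuantumLattice.fundamentalRep (Fin 3)) (fun _ : Literature.MathematicalPhysics.QuantumFieldTheory.Edge 4 L => (1 : Matrix.specialUnitaryGroup (Fin 3) ℂ)) 0 1) * Literature.MathematicalPhysics.QuantumLattice.wilsonDirac (Literature.MathematicalPhysics.QuantumLattice.fundamentalRep (Fin 3)) (fun _ : Literature.MathematicalPhysics.QuantumFieldTheory.Edge 4 L => (1 : Matrix.specialUnitaryGroup (Fin 3) ℂ)) 0 1))) (x, a, α) (x, a, α)).re) - (1 -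 Real.cos θ) / (3 * Real.pi ^ 2)| ≤ C * θ ^ 2 * (1 / t + θ ^ 2 * t ^ 2) + C * Real.exp (-(c * (L : ℝ) ^ 2 / (t + (L : ℝ)))) / t ^ 2

open Summit.QuantumFields.QCD.Theorems.TracedQuadraticParametrix.Negative in
/-- **Any proof of the crux must use the cap `t ≤ L²`.**  Witness: the one-site torus `L = 1` with the flat toron
`U(·,0) = diag(−1,−1,1)` of the sibling file `TracedQuadraticParametrix/Negative/FalseWithoutRLeL.lean` (all plaquettes
`1`, so the hypotheses hold with `θ = 0`), `t = n → ∞`: the traced kernels are `8e^{−4t} + 4` (toron: colours `0,1` are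
gapped at `4`) and `12` (free: twelve zero modes), so the left side is `8 − 8e^{−4n} ≥ 4` while the right side is
`C e^{−c/(n+1)}/n² ≤ |C|/n → 0`.  In the crux the cap makes the image allowance `Ce^{−cL²/(t+L)}/t² ≍ C/L⁴` at `t = L²`,
exactly the zero-mode scale `12/L⁴`; the finite-volume tail is therefore sharp in BOTH directions (17986: it cannot
be Gaussian in `L`; here: it cannot be asked beyond `t ≍ L²`). -/
theorem quarkLoopCoefficient_false_without_timeCap : ¬ QuarkLoopCoefficientWithoutTimeCap := by
  rintro ⟨C, c, hc, h⟩
  obtain ⟨n, hn⟩ := exists_nat_gt (max 1 |C|)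
  have hn1 : (1 : ℝ) < n := lt_of_le_of_lt (le_max_left _ _) hn
  have hnC : |C| < n := lt_of_le_of_lt (le_max_right _ _) hn
  have hn0 : (0 : ℝ) < n := by linarith
  -- hypotheses of the cap-free statement at L = 1, toron, θ = 0
  have hCartan : ∀ (e : Edge 4 1) (i j : Fin 3), i ≠ j → (fundamentalRep (Fin 3)) (toron e) i j = 0 := by
    intro e i j hij
    unfold toron
    split_ifs
    · change Pmat i j = 0
      simp [Pmat, Matrix.diagonal_apply_ne _ hij]
    · simp [Matrix.one_apply_ne hij]
  have hdiag : Matrix.diagonal ![Complex.exp (Complex.I * (0 : ℝ)), Complex.exp (-(Complex.I * (0 : ℝ))), 1] = 1 := by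
    ext i j
    fin_cases i <;> fin_cases j <;> simp
  have hFlux : ∀ y : TorusSite 4 1, (fundamentalRep (Fin 3)) (plaquetteHolonomy toron y 0 1) =
      Matrix.diagonal ![Complex.exp (Complex.I * (0 : ℝ)), Complex.exp (-(Complex.I * (0 : ℝ))), 1] := by
    intro y
    rw [plaquetteHolonomy_toron, map_one, hdiag]
  have hFlat : ∀ (y : TorusSite 4 1) (μ ν : Fin 4), ¬(μ = 0 ∧ ν = 1) → ¬(μ = 1 ∧ ν = 0) →
      plaquetteHolonomy toron y μ ν = 1 := fun y μ ν _ _ => plaquetteHolonomy_toron y μ ν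
  have key := h 1 toron 0 hCartan hFlux hFlat (n : ℝ) hn1.le (by simp) (fun _ => 0)
  have hT := trDiag_toron (n : ℝ) (fun _ => 0)
  have hF := trDiag_free_one (n : ℝ) (fun _ => 0)
  simp only [trDiag] at hT hF
  rw [hT, hF, Real.cos_zero] at key
  -- left side ≥ 4
  have hE : (2 : ℝ) ≤ Real.exp (4 * (n : ℝ)) := le_trans (by nlinarith) (Real.add_one_le_exp _)
  have he0 : 0 < Real.exp (-(4 * (n : ℝ))) := Real.exp_pos _
  have he1 : Real.exp (-(4 * (n : ℝ))) * Real.exp (4 * (n : ℝ)) = 1 := by rw [← Real.exp_add]; simp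
  have he : Real.exp (-(4 * (n : ℝ))) ≤ 1 / 2 := by nlinarith [mul_le_mul_of_nonneg_left hE he0.le]
  have hX : (4 : ℝ) ≤ |8 * Real.exp (-(4 * (n : ℝ))) + 4 - 12 - (1 - 1) / (3 * Real.pi ^ 2)| := by
    rw [abs_of_nonpos (by norm_num; linarith)]
    norm_num; linarith
  -- right side ≤ |C| / n < 1... ≤ |C|/n² ≤ |C|/n
  have hexp1 : Real.exp (-(c * ((1 : ℕ) : ℝ) ^ 2 / ((n : ℝ) + ((1 : ℕ) : ℝ)))) ≤ 1 := by
    rw [Real.exp_le_one_iff, neg_nonpos]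
    positivity
  have hR : C * (0 : ℝ) ^ 2 * (1 / (n : ℝ) + (0 : ℝ) ^ 2 * (n : ℝ) ^ 2) +
      C * Real.exp (-(c * ((1 : ℕ) : ℝ) ^ 2 / ((n : ℝ) + ((1 : ℕ) : ℝ)))) / (n : ℝ) ^ 2 ≤ |C| / n := by
    have h0 : C * (0 : ℝ) ^ 2 * (1 / (n : ℝ) + (0 : ℝ) ^ 2 * (n : ℝ) ^ 2) = 0 := by ring
    rw [h0, zero_add]
    have hnum : C * Real.exp (-(c * ((1 : ℕ) : ℝ) ^ 2 / ((n : ℝ) + ((1 : ℕ) : ℝ)))) ≤ |C| :=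
      calc C * Real.exp (-(c * ((1 : ℕ) : ℝ) ^ 2 / ((n : ℝ) + ((1 : ℕ) : ℝ))))
          ≤ |C| * Real.exp (-(c * ((1 : ℕ) : ℝ) ^ 2 / ((n : ℝ) + ((1 : ℕ) : ℝ)))) :=
            mul_le_mul_of_nonneg_right (le_abs_self C) (Real.exp_pos _).le
        _ ≤ |C| * 1 := by gcongr
        _ = |C| := mul_one _
    calc C * Real.exp (-(c * ((1 : ℕ) : ℝ) ^ 2 / ((n : ℝ) + ((1 : ℕ) : ℝ)))) / (n : ℝ) ^ 2
        ≤ |C| / (n : ℝ) ^ 2 := div_le_div_of_nonneg_right hnum (by positivity)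
      _ ≤ |C| / n := div_le_div_of_nonneg_left (abs_nonneg C) hn0 (by nlinarith)
  have hlt : |C| / (n : ℝ) < 4 := by
    rw [div_lt_iff₀ hn0]; nlinarith [abs_nonneg C]
  linarith

end Summit.QuantumFields.QCD.Theorems.QuarkLoopCoefficient.Negative
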